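import Mathlib.LinearAlgebra.QuadraticForm.Basic
import Mathlib.LinearAlgebra.Matrix.BilinearForm
import Mathlib.FieldTheory.IsAlgClosed.Basic
import Mathlib.Data.Finsupp.Multiset
import Literature.Computability.AlgebraicComplexity.MR04QuadricDeterminantalComplexity
import HarnessLib

/-!
# Mignon–Ressayre 2004, Theorem 1 for an arbitrary quadratic form ("Gauss' Theorem" reduction)

Topic `Literature/Computability/AlgebraicComplexity` (cell val-lit, typer seat t10, row MR2004-A);
closes the `TODO(general form)` of `MR04QuadricDeterminantalComplexity.lean`. Source: T. Mignon,
N. Ressayre, *A quadratic bound for the determinant and permanent problem*, IMRN 2004:79 (key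
`MignonRessayre2004`), AUTHORS' PREPRINT decoded in `pub/val-lit/lit/MR2004/txt` (preprint
numbering; locators `p. N L n` of `ALL.txt`). Everything here is PROVED; the only definition is the
plumbing `MR04Quadric.linForm w = Σ_s w_s X_s`. Honest framing: classical linear algebra
(diagonalisation of quadratic forms), formalised; `VP ≠ VNP` is not proved and nothing here is
progress on it.

## The printed statement and proof (preprint §2, p. 4 L147–151, p. 5 L190 – p. 6 L12)

"**Theorem 1.** Let `P` be a non zero quadratic form on `V`. Let `r` denote the rank of `P`. Then:
`𝒟c(P) = 2` if `r ≤ 4`; `⌈r/2⌉ + 1` else" (`𝐤` algebraically closed, p. 2 L62).  "Proof. Since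
the degree of `P` is two, `𝒟c(P) ≥ 2`. Let us assume that `r ≤ 4`. Then, by Gauss' Theorem, there
exist four linear forms `φ₁, …, φ₄` on `V` such that `P = φ₁φ₂ + φ₃φ₄`. In particular,
`P = |φ₁ -φ₃; φ₄ φ₂|`. So, `𝒟c(P) ≤ 2` … We may now assume that `r ≥ 5`. Then, Lemma 2.1 shows
that `𝒟c(P) ≥ r/2 + 1`. If `r = 2d` is even, by Gauss' Theorem there exist `2d` linear forms `φᵢ`
and `ψᵢ` such that `P = φ₁ψ₁ + ⋯ + φ_dψ_d`", followed by the bordered `(d+1) × (d+1)` matrix, and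
the odd case `r = 2d + 1` with one more square (p. 6 L1–12).

## What is proved (vocabulary of `MR04QuadricDeterminantalComplexity.lean`: the rank `r` of the
quadratic form `P` is `rank (hess0 P)`, the rank of its polar bilinear form, valid when `2 ≠ 0`)

* `MR04Quadric.exists_eq_sum_C_mul_linForm_sq` — diagonalisation ("Gauss' Theorem", any field with
  `2 ≠ 0`): `P = Σ_j (μ_j/2) ℓ_{w_j}²` for the rows `w_j` of an invertible matrix, with
  `rank H₀(P) = #{j : μ_j ≠ 0}`; from an orthogonal basis of the symmetric bilinear form of `H₀(P)`
  (Mathlib `LinearMap.BilinForm.exists_orthogonal_basis`) and the fact that a quadratic form is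
  determined by its Hessian at the origin when `2 ≠ 0`.
* `MR04Quadric.exists_eq_sum_mul_self` — over an algebraically closed field with `2 ≠ 0`, `P` is a
  sum of exactly `r = rank H₀(P)` squares of linear forms.
* `MR04Quadric.hasDetRepr_sum_mul_self_of_le` / `MR04Quadric.hasDetRepr_two_sum_mul_self` — pairing
  `a² + b² = (a + ib)(a - ib)` (`i² = -1`): `c ≤ 2q` squares give an affine determinantal
  representation of size `q + 1` (bordered matrix `MR04Quadric.hasDetRepr_sum_mul`), and `c ≤ 4`
  squares one of size `2` (the printed `2 × 2` matrix `[[φ₁, -φ₃], [φ₄, φ₂]]`).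
* `mignonRessayre2004_thm_1` — **Theorem 1 (§2 form) for every quadratic form `P` over an
  algebraically closed field with `2 ≠ 0`**: if `r = rank H₀(P) ≥ 5` then
  `2 · dc(P) = r + 2 + (r mod 2)`, i.e. `dc(P) = ⌈r/2⌉ + 1` (lower bound
  `mignonRessayre2004_thm_1_lower` = Lemma 2.1; upper bound by Gauss reduction and pairing); and
  `mignonRessayre2004_thm_1_of_rank_le_four`: `dc(P) = 2` if `1 ≤ r ≤ 4`.  (As recorded in the
  companion file: the preprint's introduction, p. 2 L62–69, prints `⌈(r+1)/2⌉`, a misprint for odd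
  `r`; and Alper–Bogart–Velasco 2017 misquote the `r = 4` value.)

## References

* T. Mignon, N. Ressayre, IMRN 2004:79, 4241–4253, doi:10.1155/S1073792804142566 (key
  `MignonRessayre2004`); authors' preprint, §2 (p. 4–6), decoded in `pub/val-lit/lit/MR2004/txt`.
-/

noncomputable section

open MvPolynomial Matrix Finset

namespace Literature.Computability.AlgebraicComplexity

namespace MR04Quadric

variable {k : Type*} [Field k] {σ : Type*}

/-! ### A quadratic form is determined by its Hessian at the origin (`2 ≠ 0`) -/

/-- Entries of `H₀(f)` are degree-`2` coefficients: `H₀(f)_{st} = (1 + [s = t]) · coeff_{e_s + e_t} f`.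
[folklore] -/
private theorem hess0_apply_eq_coeff (f : MvPolynomial σ k) (s t : σ) :
    hess0 f s t = coeff (Finsupp.single s 1 + Finsupp.single t 1) f *
      (((Finsupp.single s 1 : σ →₀ ℕ) t : k) + 1) := by
  classical
  rw [hess0_apply]
  show coeff 0 (pderiv s (pderiv t f)) = _
  rw [coeff_pderiv, zero_add, coeff_pderiv]
  simp

/-- A finsupp of degree `2` is `e_s + e_t`. [folklore] -/
private theorem exists_eq_single_add_single {d : σ →₀ ℕ} (hd : d.degree = 2) :
    ∃ s t : σ, d = Finsupp.single s 1 + Finsupp.single t 1 := by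
  classical
  have hcard : Multiset.card (Finsupp.toMultiset d) = 2 := by
    rw [Finsupp.card_toMultiset, ← hd]
    rfl
  obtain ⟨s, t, hst⟩ := Multiset.card_eq_two.1 hcard
  refine ⟨s, t, ?_⟩
  rw [← Finsupp.toMultiset_toFinsupp d, hst, Multiset.insert_eq_cons, ← Multiset.singleton_add,
    map_add, Multiset.toFinsupp_singleton, Multiset.toFinsupp_singleton]

/-- **A quadratic form is determined by its Hessian at the origin** when `2 ≠ 0`. [folklore] -/
private theorem eq_of_hess0_eq (h2 : (2 : k) ≠ 0) {P Q : MvPolynomial σ k} (hP : P.IsHomogeneous 2)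
    (hQ : Q.IsHomogeneous 2) (h : hess0 P = hess0 Q) : P = Q := by
  classical
  ext d
  by_cases hd : d.degree = 2
  · obtain ⟨s, t, rfl⟩ := exists_eq_single_add_single hd
    have hs := congr_fun (congr_fun h s) t
    rw [hess0_apply_eq_coeff, hess0_apply_eq_coeff] at hs
    refine mul_right_cancel₀ ?_ hs
    rw [Finsupp.single_apply]
    split_ifs
    · rw [Nat.cast_one, one_add_one_eq_two]
      exact h2
    · rw [Nat.cast_zero, zero_add]
      exact one_ne_zero
  · rw [hP.coeff_eq_zero hd, hQ.coeff_eq_zero hd]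

/-! ### Linear forms with prescribed coefficient vector -/

section LinForm

variable [Fintype σ]

/-- The linear form `ℓ_w = Σ_s w_s X_s`. [folklore] -/
def linForm (w : σ → k) : MvPolynomial σ k := ∑ s, C (w s) * X s

omit [Fintype σ] in
/-- `∇X_s = e_s`. [folklore] -/
private theorem linPart_X' [DecidableEq σ] (s a : σ) :
    linPart (X s : MvPolynomial σ k) a = if a = s then 1 else 0 := by
  rw [linPart_apply, pderiv_X, Pi.single_apply]
  by_cases h : a = s
  · subst h
    simp
  · rw [if_neg (Ne.symm h), if_neg h, map_zero]

/-- `ℓ_w(0) = 0`. [folklore] -/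
private theorem constantCoeff_linForm (w : σ → k) : constantCoeff (linForm w) = 0 := by
  simp [linForm]

/-- `ℓ_w` is affine. [folklore] -/
private theorem totalDegree_linForm_le (w : σ → k) : (linForm w).totalDegree ≤ 1 := by
  refine totalDegree_finsetSum_le fun s _ => (totalDegree_mul _ _).trans ?_
  rw [totalDegree_C, zero_add]
  exact (totalDegree_X (R := k) s).le

/-- `∇ℓ_w = w`. [folklore] -/
private theorem linPart_linForm (w : σ → k) : linPart (linForm w) = w := by
  classical
  funext a
  rw [linForm, linPart_apply, map_sum, map_sum]
  simp_rw [Derivation.leibniz, pderiv_C, smul_zero, add_zero, smul_eq_mul, map_mul, constantCoeff_C]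
  have : ∀ s, constantCoeff (pderiv a (X s : MvPolynomial σ k)) = if a = s then 1 else 0 :=
    fun s => linPart_X' s a
  simp_rw [this]
  simp

/-- `H₀(c · ℓ_w²) = 2c · w wᵀ`. [folklore] -/
private theorem hess0_C_mul_linForm_sq_apply (c : k) (w : σ → k) (s t : σ) :
    hess0 (C c * (linForm w * linForm w)) s t = 2 * c * (w s * w t) := by
  rw [hess0_C_mul, Matrix.smul_apply, hess0_mul, constantCoeff_linForm, zero_smul, zero_add,
    zero_add, Matrix.add_apply, vecMulVec_apply, linPart_linForm, smul_eq_mul]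
  ring

/-- `c · ℓ_w²` is a quadratic form. [folklore] -/
private theorem isHomogeneous_C_mul_linForm_sq (c : k) (w : σ → k) :
    (C c * (linForm w * linForm w)).IsHomogeneous 2 := by
  have h1 : (linForm w).IsHomogeneous 1 :=
    IsHomogeneous.sum _ _ _ fun s _ => (isHomogeneous_X k s).C_mul (w s)
  exact (h1.mul h1).C_mul c

end LinForm

/-! ### Gauss reduction: a quadratic form is a sum of `rank` squares of linear forms -/

section Gauss

variable [Fintype σ] [DecidableEq σ]

omit [Fintype σ] [DecidableEq σ] in
/-- `H₀(f)` is symmetric. [folklore] -/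
private theorem hess0_isSymm (f : MvPolynomial σ k) : (hess0 f).IsSymm := by
  classical
  ext s t
  rw [Matrix.transpose_apply, hess0_apply_eq_coeff, hess0_apply_eq_coeff,
    add_comm (Finsupp.single t 1), Finsupp.single_apply, Finsupp.single_apply]
  by_cases h : s = t
  · subst h
    rfl
  · rw [if_neg h, if_neg (Ne.symm h)]

/-- **Diagonalisation of the Hessian.** For a quadratic form `P` over a field with `2 ≠ 0`
there are scalars `μ_j` and an invertible matrix `W` (rows `w_j`) with
`P = Σ_j (μ_j / 2) ℓ_{w_j}²` and `rank H₀(P) = #{j : μ_j ≠ 0}` (an orthogonal basis for the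
symmetric bilinear form of `H₀(P)`, Mathlib `LinearMap.BilinForm.exists_orthogonal_basis`) —
the "Gauss' Theorem" invoked at preprint p. 5 L192 and L198.
[cite: MignonRessayre2004, Theorem 1 (preprint §2, p. 5, proof: "Gauss' Theorem")] -/
theorem exists_eq_sum_C_mul_linForm_sq (h2 : (2 : k) ≠ 0) {P : MvPolynomial σ k}
    (hP : P.IsHomogeneous 2) :
    ∃ (μ : σ → k) (W : Matrix σ σ k) (J : Finset σ), IsUnit W.det ∧ (∀ j, j ∈ J ↔ μ j ≠ 0) ∧
      P = ∑ j, C (μ j / 2) * (linForm (W j) * linForm (W j)) ∧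
      (hess0 P).rank = J.card := by
  classical
  haveI : Invertible (2 : k) := invertibleOfNonzero h2
  set H : Matrix σ σ k := hess0 P with hHdef
  set B : LinearMap.BilinForm k (σ → k) := Matrix.toBilin' H with hB
  have hBs : B.IsSymm := Matrix.isSymm_toBilin'_iff_isSymm.2 (hess0_isSymm P)
  obtain ⟨v₀, hv₀⟩ :=
    LinearMap.BilinForm.exists_orthogonal_basis (LinearMap.BilinForm.isSymm_iff.1 hBs)
  let e : Fin (Module.finrank k (σ → k)) ≃ σ :=
    (finCongr (Module.finrank_fintype_fun_eq_card k)).trans (Fintype.equivFin σ).symm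
  let v : Module.Basis σ k (σ → k) := v₀.reindex e
  have hv : ∀ i j, i ≠ j → B (v i) (v j) = 0 := by
    intro i j hij
    have h := hv₀ (e.symm.injective.ne hij)
    simpa [v, Module.Basis.reindex_apply] using h
  let μ : σ → k := fun j => B (v j) (v j)
  let V : Matrix σ σ k := (Pi.basisFun k σ).toMatrix v
  let W : Matrix σ σ k := v.toMatrix (Pi.basisFun k σ)
  have hVW : V * W = 1 := Module.Basis.toMatrix_mul_toMatrix_flip _ _
  have hWV : W * V = 1 := Module.Basis.toMatrix_mul_toMatrix_flip _ _
  have hVapply : ∀ s j, V s j = v j s := fun s j => by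
    simp [V, Module.Basis.toMatrix_apply, Pi.basisFun_repr]
  -- `Vᵀ H V = diag μ`
  have hD : Vᵀ * H * V = diagonal μ := by
    ext i j
    have hBij : B (v i) (v j) = ∑ s, ∑ t, v i s * H s t * v j t := Matrix.toBilin'_apply H _ _
    have hentry : (Vᵀ * H * V) i j = B (v i) (v j) := by
      rw [hBij, Matrix.mul_apply]
      simp_rw [Matrix.mul_apply, Matrix.transpose_apply, hVapply, Finset.sum_mul]
      rw [Finset.sum_comm]
    rw [hentry, diagonal_apply]
    split_ifs with hij
    · subst hij
      rfl
    · exact hv i j hij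
  -- `H = Wᵀ diag(μ) W`
  have hHW : H = Wᵀ * diagonal μ * W := by
    have h : Wᵀ * (Vᵀ * H * V) * W = (V * W)ᵀ * H * (V * W) := by
      rw [Matrix.transpose_mul]
      simp only [Matrix.mul_assoc]
    rw [hVW, transpose_one, Matrix.one_mul, Matrix.mul_one, hD] at h
    exact h.symm
  have hWdet : IsUnit W.det := Matrix.isUnit_det_of_right_inverse hWV
  refine ⟨μ, W, univ.filter fun j => μ j ≠ 0, hWdet, fun j => by simp, ?_, ?_⟩
  · -- the polynomial identity, by comparing Hessians
    refine eq_of_hess0_eq h2 hP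
      (IsHomogeneous.sum _ _ _ fun j _ => isHomogeneous_C_mul_linForm_sq _ _) ?_
    ext s t
    rw [← hHdef, hHW, map_sum, Matrix.sum_apply, Matrix.mul_apply]
    simp only [hess0_C_mul_linForm_sq_apply, Matrix.mul_diagonal, Matrix.transpose_apply]
    refine Finset.sum_congr rfl fun j _ => ?_
    field_simp
  · -- the rank
    rw [hHW, Matrix.mul_assoc,
      Matrix.rank_mul_eq_right_of_isUnit_det Wᵀ _ (by rwa [det_transpose]),
      Matrix.rank_mul_eq_left_of_isUnit_det W _ hWdet, Matrix.rank_diagonal,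
      Fintype.card_subtype]

/-- **Gauss reduction** ("by Gauss' Theorem there exist `2d` linear forms …", preprint p. 5
L190–199): over an algebraically closed field with `2 ≠ 0`, a quadratic form `P` with
`rank H₀(P) = r` is a sum of `r` squares of linear forms. [cite: MignonRessayre2004, Theorem 1 (preprint §2, p. 5, proof)] -/
theorem exists_eq_sum_mul_self [IsAlgClosed k] (h2 : (2 : k) ≠ 0) {P : MvPolynomial σ k}
    (hP : P.IsHomogeneous 2) :
    ∃ m : Fin (hess0 P).rank → MvPolynomial σ k,
      (∀ t, (m t).totalDegree ≤ 1) ∧ P = ∑ t, m t * m t := by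
  classical
  obtain ⟨μ, W, J, -, hJ, hPW, hr⟩ := exists_eq_sum_C_mul_linForm_sq h2 hP
  have hsq : ∀ j, ∃ z : k, μ j / 2 = z * z := fun j => IsAlgClosed.exists_eq_mul_self _
  choose ν hν using hsq
  -- restrict to `J` and take square roots
  have hPJ : P = ∑ j ∈ J, (C (ν j) * linForm (W j)) * (C (ν j) * linForm (W j)) := by
    rw [hPW, ← Finset.sum_subset (Finset.subset_univ J)]
    · refine Finset.sum_congr rfl fun j _ => ?_
      rw [hν, map_mul]
      ring
    · intro j _ hj
      have hj0 : μ j = 0 := by simpa [hJ] using hj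
      rw [hj0, zero_div, map_zero, zero_mul]
  -- reindex `J` by `Fin r`
  let e : J ≃ Fin (hess0 P).rank :=
    (Fintype.equivFin J).trans (finCongr (by rw [Fintype.card_coe, hr]))
  refine ⟨fun t => C (ν (e.symm t)) * linForm (W (e.symm t)), fun t => ?_, ?_⟩
  · refine (totalDegree_mul _ _).trans ?_
    rw [totalDegree_C, zero_add]
    exact totalDegree_linForm_le _
  · calc P = ∑ j ∈ J, (C (ν j) * linForm (W j)) * (C (ν j) * linForm (W j)) := hPJ
      _ = ∑ j : J, (C (ν (j : σ)) * linForm (W j)) * (C (ν (j : σ)) * linForm (W j)) :=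
          (Finset.sum_coe_sort J _).symm
      _ = ∑ t, (C (ν (e.symm t : σ)) * linForm (W (e.symm t))) *
            (C (ν (e.symm t : σ)) * linForm (W (e.symm t))) :=
          (Equiv.sum_comp e.symm (fun j : J =>
            (C (ν (j : σ)) * linForm (W j)) * (C (ν (j : σ)) * linForm (W j)))).symm

end Gauss

/-! ### Pairing squares into products: `a² + b² = (a + ib)(a - ib)` -/

section Pairing

variable {c : ℕ}

/-- Zero-padding of a finite family. [folklore] -/
private def pad (m : Fin c → MvPolynomial σ k) (t : ℕ) : MvPolynomial σ k :=
  if h : t < c then m ⟨t, h⟩ else 0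

/-- Padded entries are affine. [folklore] -/
private theorem totalDegree_pad_le (m : Fin c → MvPolynomial σ k)
    (hm : ∀ t, (m t).totalDegree ≤ 1) (t : ℕ) : (pad m t).totalDegree ≤ 1 := by
  unfold pad
  split_ifs
  · exact hm _
  · rw [totalDegree_zero]
    exact zero_le_one

/-- The padded sum of squares equals the original one. [folklore] -/
private theorem sum_pad_mul_pad (m : Fin c → MvPolynomial σ k) {N : ℕ} (hN : c ≤ N) :
    ∑ t ∈ range N, pad m t * pad m t = ∑ t, m t * m t := by
  rw [← Finset.sum_subset (Finset.range_subset_range.2 hN)]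
  · rw [← Fin.sum_univ_eq_sum_range (fun t => pad m t * pad m t) c]
    refine Finset.sum_congr rfl fun t _ => ?_
    simp only [pad, dif_pos t.2, Fin.eta]
  · intro t _ ht
    have htc : ¬ t < c := by simpa using ht
    simp [pad, htc]

/-- `Σ_{t<2q} f t = Σ_{i<q} (f(2i) + f(2i+1))`. [folklore] -/
private theorem sum_range_two_mul {M : Type*} [AddCommMonoid M] (f : ℕ → M) (q : ℕ) :
    ∑ t ∈ range (2 * q), f t = ∑ i ∈ range q, (f (2 * i) + f (2 * i + 1)) := by
  induction q with
  | zero => simp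
  | succ q ih =>
    rw [Finset.sum_range_succ, ← ih, show 2 * (q + 1) = 2 * q + 1 + 1 by ring,
      Finset.sum_range_succ, Finset.sum_range_succ, add_assoc]

/-- `(a + ib)(a - ib) = a² + b²` when `i² = -1`. [folklore] -/
private theorem pair_mul {i : k} (hi : i * i = -1) (a b : MvPolynomial σ k) :
    (a + C i * b) * (a - C i * b) = a * a + b * b := by
  have h : C i * C i = (-1 : MvPolynomial σ k) := by rw [← map_mul, hi, map_neg, map_one]
  linear_combination (-(b * b)) * h

/-- `a ± ib` are affine when `a, b` are. [folklore] -/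
private theorem totalDegree_pair_le {i : k} {a b : MvPolynomial σ k} (ha : a.totalDegree ≤ 1)
    (hb : b.totalDegree ≤ 1) :
    (a + C i * b).totalDegree ≤ 1 ∧ (a - C i * b).totalDegree ≤ 1 := by
  have hcb : (C i * b).totalDegree ≤ 1 := (totalDegree_mul _ _).trans (by
    rw [totalDegree_C, zero_add]; exact hb)
  exact ⟨(totalDegree_add _ _).trans (max_le ha hcb),
    (totalDegree_sub _ _).trans (max_le ha hcb)⟩

/-- **Pairing squares into products** (preprint p. 5 L199 – p. 6 L12: the `d` products `φᵢψᵢ`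
of the even case and the extra pair of the odd case): if `i² = -1` in `k`, a sum of `c ≤ 2q`
squares of affine forms is a sum of `q` products `(a + ib)(a - ib)` of affine forms, hence
has an affine determinantal representation of size `q + 1` (bordered matrix).
[cite: MignonRessayre2004, Theorem 1 (preprint §2, p. 5–6, proof)] -/
theorem hasDetRepr_sum_mul_self_of_le {q : ℕ} (m : Fin c → MvPolynomial σ k)
    (hm : ∀ t, (m t).totalDegree ≤ 1) {i : k} (hi : i * i = -1) (hcq : c ≤ 2 * q) :
    HasDetRepr (∑ t, m t * m t) (q + 1) := by
  classical
  have hsum : ∑ t, m t * m t =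
      ∑ j : Fin q, (pad m (2 * j) + C i * pad m (2 * j + 1)) *
        (pad m (2 * j) - C i * pad m (2 * j + 1)) := by
    simp_rw [pair_mul hi]
    rw [Fin.sum_univ_eq_sum_range (fun j => pad m (2 * j) * pad m (2 * j) +
      pad m (2 * j + 1) * pad m (2 * j + 1)) q, ← sum_range_two_mul (fun t => pad m t * pad m t),
      sum_pad_mul_pad m hcq]
  rw [hsum]
  have h := hasDetRepr_sum_mul (fun j : Fin q => pad m (2 * j) + C i * pad m (2 * j + 1))
    (fun j => pad m (2 * j) - C i * pad m (2 * j + 1))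
    (fun j => (totalDegree_pair_le (totalDegree_pad_le m hm _) (totalDegree_pad_le m hm _)).1)
    (fun j => (totalDegree_pair_le (totalDegree_pad_le m hm _) (totalDegree_pad_le m hm _)).2)
  rwa [Fintype.card_fin] at h

/-- **The `2 × 2` matrix of the case `r ≤ 4`** (preprint p. 5 L193–195: "`P = φ₁φ₂ + φ₃φ₄`. In
particular, `P = |φ₁ -φ₃; φ₄ φ₂|`. So, `𝒟c(P) ≤ 2`"): a sum of `c ≤ 4` squares of affine forms has
an affine determinantal representation of size `2` (`i² = -1`).
[cite: MignonRessayre2004, Theorem 1 (preprint §2, p. 5, proof)] -/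
theorem hasDetRepr_two_sum_mul_self (m : Fin c → MvPolynomial σ k)
    (hm : ∀ t, (m t).totalDegree ≤ 1) {i : k} (hi : i * i = -1) (hc : c ≤ 4) :
    HasDetRepr (∑ t, m t * m t) 2 := by
  classical
  have hsum : ∑ t, m t * m t =
      (pad m 0 + C i * pad m 1) * (pad m 0 - C i * pad m 1) +
        (pad m 2 + C i * pad m 3) * (pad m 2 - C i * pad m 3) := by
    rw [pair_mul hi, pair_mul hi, ← sum_pad_mul_pad m hc]
    simp only [Finset.sum_range_succ, Finset.sum_range_zero, zero_add]
    ring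
  rw [hsum]
  refine ⟨!![pad m 0 + C i * pad m 1, -(pad m 2 + C i * pad m 3);
      pad m 2 - C i * pad m 3, pad m 0 - C i * pad m 1], fun a b => ?_, ?_⟩
  · have h01 := totalDegree_pair_le (i := i) (totalDegree_pad_le m hm 0) (totalDegree_pad_le m hm 1)
    have h23 := totalDegree_pair_le (i := i) (totalDegree_pad_le m hm 2) (totalDegree_pad_le m hm 3)
    fin_cases a <;> fin_cases b
    · exact h01.1
    · show (-(pad m 2 + C i * pad m 3)).totalDegree ≤ 1
      rw [totalDegree_neg]
      exact h23.1
    · exact h23.2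
    · exact h01.2
  · rw [Matrix.det_fin_two_of]
    ring

end Pairing

end MR04Quadric

open MR04Quadric

/-! ### Theorem 1 for an arbitrary quadratic form -/

/-- **Mignon–Ressayre 2004, Theorem 1 (§2 form), rank `r ≥ 5`** (preprint p. 4 L147–151: "Let `P`
be a non zero quadratic form on `V`. Let `r` denote the rank of `P`. Then: `𝒟c(P) = 2` if `r ≤ 4`;
`⌈r/2⌉ + 1` else", `𝐤` algebraically closed), for EVERY quadratic form `P` (homogeneous polynomial
of degree `2`) over an algebraically closed field with `2 ≠ 0`, with `r = rank H₀(P)`: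
if `r ≥ 5` then `2 · dc(P) = r + 2 + (r mod 2)`, i.e. `dc(P) = ⌈r/2⌉ + 1`.  Lower bound: Lemma 2.1
(`mignonRessayre2004_thm_1_lower`); upper bound: Gauss reduction to `r` squares
(`MR04Quadric.exists_eq_sum_mul_self`), pairing and the bordered matrix
(`MR04Quadric.hasDetRepr_sum_mul_self_of_le`). (The introduction of the preprint, p. 2 L62–69,
prints `⌈(r+1)/2⌉` — not what is proved for odd `r`.)
[cite: MignonRessayre2004, Theorem 1 (preprint §2, p. 4 L147–151)] -/
theorem mignonRessayre2004_thm_1 {k : Type*} [Field k] [IsAlgClosed k] {σ : Type*} [Fintype σ]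
    [DecidableEq σ] (h2 : (2 : k) ≠ 0) {P : MvPolynomial σ k} (hP : P.IsHomogeneous 2)
    (hr : 5 ≤ (hess0 P).rank) :
    2 * determinantalComplexity P = (hess0 P).rank + 2 + (hess0 P).rank % 2 := by
  obtain ⟨m, hm, hPm⟩ := exists_eq_sum_mul_self h2 hP
  obtain ⟨i, hi⟩ := IsAlgClosed.exists_eq_mul_self (-1 : k)
  have hup : determinantalComplexity (∑ t, m t * m t) ≤
      ((hess0 P).rank / 2 + (hess0 P).rank % 2) + 1 :=
    determinantalComplexity_le_of_hasDetRepr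
      (hasDetRepr_sum_mul_self_of_le m hm hi.symm (by omega))
  rw [← hPm] at hup
  have hlow := mignonRessayre2004_thm_1_lower hP hr
  omega

/-- **Mignon–Ressayre 2004, Theorem 1 (§2 form), rank `1 ≤ r ≤ 4`**: `dc(P) = 2` for every quadratic
form `P` with `1 ≤ rank H₀(P) ≤ 4` over an algebraically closed field with `2 ≠ 0` (preprint p. 5
L191–195: `𝒟c ≥ deg = 2`, and `P = φ₁φ₂ + φ₃φ₄ = det [[φ₁, -φ₃], [φ₄, φ₂]]`); in particular
`dc = 2` at `r = 4`, the value misquoted as `⌈(r+1)/2⌉ = 3` in Alper–Bogart–Velasco 2017, p. 3.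
[cite: MignonRessayre2004, Theorem 1 (preprint §2, p. 4 L147–151)] -/
theorem mignonRessayre2004_thm_1_of_rank_le_four {k : Type*} [Field k] [IsAlgClosed k]
    {σ : Type*} [Fintype σ] [DecidableEq σ] (h2 : (2 : k) ≠ 0) {P : MvPolynomial σ k}
    (hP : P.IsHomogeneous 2) (h1 : 1 ≤ (hess0 P).rank) (h4 : (hess0 P).rank ≤ 4) :
    determinantalComplexity P = 2 := by
  obtain ⟨m, hm, hPm⟩ := exists_eq_sum_mul_self h2 hP
  obtain ⟨i, hi⟩ := IsAlgClosed.exists_eq_mul_self (-1 : k)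
  refine le_antisymm ?_ ?_
  · have hup : determinantalComplexity (∑ t, m t * m t) ≤ 2 :=
      determinantalComplexity_le_of_hasDetRepr (hasDetRepr_two_sum_mul_self m hm hi.symm h4)
    rwa [← hPm] at hup
  · have hP0 : P ≠ 0 := by
      intro h
      rw [h, map_zero, Matrix.rank_zero] at h1
      exact Nat.not_succ_le_zero 0 h1
    have h := totalDegree_le_determinantalComplexity_holds P
    rwa [hP.totalDegree hP0] at h

end Literature.Computability.AlgebraicComplexity
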